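import Literature.NumberTheory.EllipticCurves.ShaRestrictionIndex
import Literature.NumberTheory.EllipticCurves.SelmerCorankProofs
import Literature.NumberTheory.QuadraticForms.LocalNormIndex
import Mathlib.NumberTheory.NumberField.Completion.Ramification
import Mathlib.FieldTheory.KrullTopology
import HarnessLib

/-!
# Local kernels along a quadratic extension are killed by `2`

For a Weierstrass curve `W` (an elliptic curve `E`) over a field `K` and a tower of `K`-fields
`K → E → E'` with `E'/E` finite, a class of `H¹(K, E)` which dies in `H¹(E', E)` is killed, after
multiplication by `[Ẽ' : E]` (`Ẽ'` the Galois closure of `E'/E`), in `H¹(E, E)` — the converse,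
up to the index, of the tree's `localRestrictionKer_le_of_tower` (`ShaRestriction`): the kernel
of `H¹(E, ·) → H¹(E', ·)` is inflated from `Gal(Ẽ'/E)` (`resKer_le_range_inflClass`) and killed
by its order (`index_nsmul_inflClass`). For `[E' : E] ≤ 2` the factor is `2`
(`two_nsmul_mem_localRestrictionKer_of_tower`).

Applied to the completions `K_v → L_w` of a quadratic extension of number fields `L/K` at every
place (`[L_w : K_v] ≤ [L : K] = 2`: the tree's `finrank_adicCompletion_le` of
`QuadraticForms/LocalNormIndex` at finite places, Mathlib's
`NumberField.InfinitePlace.Completion.finrank_eq_two_of_isRamified` /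
`finrank_eq_one_of_isUnramified` at infinite places), this gives:

* `two_nsmul_mem_sha_of_resBaseChange_mem_sha` — if `res x ∈ Ш(E_L/L)` then `2 x ∈ Ш(E/K)`;
* `two_nsmul_mem_selmerGroupPInfty_of_res_mem` — if the restriction of `η ∈ H¹(K, E[p^∞])`
  lies in `Sel_{p^∞}(E_L/L)` then `2 η ∈ Sel_{p^∞}(E/K)`

(the local ingredient of Dokchitser–Dokchitser, Ann. of Math. 172 (2010), proof of Lemma 4.14:
"cokernel killed by `|G|²`" — restriction identifies `Sel(E/K)`, up to `|G|`-power torsion,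
with the `G`-invariants of `Sel(E/F)`). Everything here is proved.

## References

* T. Dokchitser, V. Dokchitser, Ann. of Math. 172 (2010), Lemma 4.14 (proof).
  [DokchitserDokchitserAnnals2010]
* J.-P. Serre, *Galois Cohomology* (1997), I.§2.4 (Cor. to Prop. 9), I.§5.8, II.§1.1.
  [SerreGaloisCohomology1997]
-/

noncomputable section

open scoped Classical

universe u

namespace Literature.NumberTheory.EllipticCurves

open GaloisRepresentations WeierstrassCurve IntermediateField

/-! ## The Galois closure of a finite extension inside the algebraic closure -/

section FinClosure

variable {E : Type u} [Field E] (E' : Type u) [Field E'] [Algebra E E'] [FiniteDimensional E E']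

/-- The Galois closure `Ẽ'` of a finite extension `E'/E` inside `Ē` (Mathlib's
`IntermediateField.normalClosure`; the tree's `galoisClosureIn` for number fields).
Serre, *Galois Cohomology*, II.§1.1. [folklore] -/
def finGaloisClosure : IntermediateField E (AlgebraicClosure E) :=
  IntermediateField.normalClosure E E' (AlgebraicClosure E)

/-- `Ẽ'/E` is finite. [folklore] -/
instance finiteDimensional_finGaloisClosure : FiniteDimensional E (finGaloisClosure (E := E) E') := by
  unfold finGaloisClosure; infer_instance

/-- `Ẽ'/E` is Galois for `E` perfect. [folklore] -/
instance isGalois_finGaloisClosure [PerfectField E] : IsGalois E (finGaloisClosure (E := E) E') := by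
  haveI : Normal E (finGaloisClosure (E := E) E') := by
    unfold finGaloisClosure; infer_instance
  exact {}

/-- The open subgroup `Γ_{Ẽ'} = Gal(Ē/Ẽ') ≤ Γ_E`. [folklore] -/
def finGalSubgroup : Subgroup (Field.absoluteGaloisGroup E) :=
  (finGaloisClosure (E := E) E').fixingSubgroup

/-- `Γ_{Ẽ'}` is open. [folklore] -/
theorem isOpen_finGalSubgroup :
    IsOpen (finGalSubgroup (E := E) E' : Set (Field.absoluteGaloisGroup E)) :=
  IntermediateField.fixingSubgroup_isOpen _

/-- `Γ_{Ẽ'}` has finite index (open in the compact `Γ_E`). [folklore] -/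
instance finiteIndex_finGalSubgroup [PerfectField E] : (finGalSubgroup (E := E) E').FiniteIndex := by
  haveI : CompactSpace (Field.absoluteGaloisGroup E) := compactSpace_absoluteGaloisGroup E
  haveI : Finite (Field.absoluteGaloisGroup E ⧸ finGalSubgroup (E := E) E') :=
    Subgroup.quotient_finite_of_isOpen _ (isOpen_finGalSubgroup E')
  exact Subgroup.finiteIndex_of_finite_quotient

omit [FiniteDimensional E E'] in
/-- `[Γ_E : Γ_{Ẽ'}] = [Ẽ' : E]` (infinite Galois theory for `Ē/E`). [folklore] -/
theorem index_finGalSubgroup_eq [PerfectField E] :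
    (finGalSubgroup (E := E) E').index = Module.finrank E (finGaloisClosure (E := E) E') := by
  haveI : IsGalois E (AlgebraicClosure E) := {}
  exact (IntermediateField.finrank_eq_fixingSubgroup_index (finGaloisClosure (E := E) E')).symm

omit [FiniteDimensional E E'] in
/-- `[Ẽ' : E] = [E' : E]` for `E'/E` Galois (uniqueness of normal closures). [folklore] -/
theorem finrank_finGaloisClosure_eq [IsGalois E E'] :
    Module.finrank E (finGaloisClosure (E := E) E') = Module.finrank E E' := by
  haveI : Normal E (AlgebraicClosure E) := IsAlgClosure.normal E (AlgebraicClosure E)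
  haveI : Nonempty (E' →ₐ[E] AlgebraicClosure E) := ⟨IsAlgClosed.lift⟩
  haveI : IsNormalClosure E E' E' := isNormalClosure_self E E'
  haveI : IsNormalClosure E E' (finGaloisClosure (E := E) E') := by
    unfold finGaloisClosure; infer_instance
  exact (IsNormalClosure.equiv (F := E) (K := E') (L := E')
    (L' := finGaloisClosure (E := E) E')).toLinearEquiv.finrank_eq.symm

/-- `Γ_{Ẽ'}` is contained in the image of the restriction `Γ_{E'} → Γ_E` (an automorphism of `Ē`
fixing `Ẽ' ⊇ E'` extends through `Ē ≃ Ē'` to an `E'`-automorphism of `Ē'` restricting to it).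
Serre, *Galois Cohomology*, II.§1.1. (The tree's `galSubgroupClosure_le_range_resGal`, verbatim,
for arbitrary finite extensions.) [folklore] -/
theorem finGalSubgroup_le_range_resGal :
    finGalSubgroup (E := E) E' ≤ ((resGal (K := E) E' : Field.absoluteGaloisGroup E' →ₜ*
      Field.absoluteGaloisGroup E) : Field.absoluteGaloisGroup E' →* Field.absoluteGaloisGroup E).range := by
  intro τ hτ
  let ι : AlgebraicClosure E →ₐ[E] AlgebraicClosure E' := closureEmb (K := E) E'
  let e : AlgebraicClosure E ≃ₐ[E] AlgebraicClosure E' := algEquivOfEmb E' ι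
  let j : E' →ₐ[E] AlgebraicClosure E :=
    (e.symm : AlgebraicClosure E' →ₐ[E] AlgebraicClosure E).comp
      (IsScalarTower.toAlgHom E E' (AlgebraicClosure E'))
  have hj : ∀ x : E', j x ∈ finGaloisClosure (E := E) E' := fun x ↦
    AlgHom.fieldRange_le_normalClosure j ⟨x, rfl⟩
  let τ' : AlgebraicClosure E ≃ₐ[E] AlgebraicClosure E := τ
  let r : AlgebraicClosure E' ≃+* AlgebraicClosure E' :=
    (e.symm.toRingEquiv.trans τ'.toRingEquiv).trans e.toRingEquiv
  have hr : ∀ z, r z = e (τ' (e.symm z)) := fun z ↦ rfl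
  have hrL : ∀ x : E', r (algebraMap E' (AlgebraicClosure E') x) =
      algebraMap E' (AlgebraicClosure E') x := by
    intro x
    rw [hr]
    have h1 : e.symm (algebraMap E' (AlgebraicClosure E') x) = j x := rfl
    rw [h1, (IntermediateField.mem_fixingSubgroup_iff _ _).mp hτ (j x) (hj x), ← h1,
      AlgEquiv.apply_symm_apply]
  let σ : AlgebraicClosure E' ≃ₐ[E'] AlgebraicClosure E' := AlgEquiv.ofRingEquiv (f := r) hrL
  refine ⟨σ, ?_⟩
  apply AlgEquiv.ext
  intro z
  apply ι.injective
  change ι ((show AlgebraicClosure E ≃ₐ[E] AlgebraicClosure E from resGalAuxOfEmb ι σ) z) = ι (τ' z)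
  rw [apply_resGalAuxOfEmb_apply]
  change r (ι z) = ι (τ' z)
  rw [hr]
  have h2 : e.symm (ι z) = z := by
    rw [← algEquivOfEmb_apply E' ι z]
    exact e.symm_apply_apply z
  rw [h2]
  rfl

/-- An extension of degree `≤ 2` (and finite) is Galois: degree `1` means `E' = E`, degree `2` is
a quadratic extension (Mathlib `IsQuadraticExtension.isGalois`). [folklore] -/
theorem isGalois_of_finrank_le_two [CharZero E] (h : Module.finrank E E' ≤ 2) : IsGalois E E' := by
  have hpos : 0 < Module.finrank E E' := Module.finrank_pos
  rcases Nat.lt_or_ge (Module.finrank E E') 2 with hlt | hge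
  · -- degree `1`
    have h1 : Module.finrank E E' = 1 := by omega
    have hsurj : Function.Surjective (algebraMap E E') := fun x ↦ by
      have hx : x ∈ (⊤ : Subalgebra E E') := Algebra.mem_top
      rw [← Subalgebra.bot_eq_top_of_finrank_eq_one h1, Algebra.mem_bot] at hx
      exact hx
    let f : E ≃ₐ[E] E' :=
      AlgEquiv.ofBijective (Algebra.ofId E E') ⟨(algebraMap E E').injective, hsurj⟩
    exact IsGalois.of_algEquiv f
  · haveI : Algebra.IsQuadraticExtension E E' := ⟨le_antisymm h hge⟩
    infer_instance

/-- For `[E' : E] ≤ 2`, the index `[Γ_E : Γ_{Ẽ'}]` divides `2`. [folklore] -/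
theorem index_finGalSubgroup_dvd_two [CharZero E] (h : Module.finrank E E' ≤ 2) :
    (finGalSubgroup (E := E) E').index ∣ 2 := by
  haveI := isGalois_of_finrank_le_two E' h
  rw [index_finGalSubgroup_eq, finrank_finGaloisClosure_eq]
  have hpos : 0 < Module.finrank E E' := Module.finrank_pos
  interval_cases (Module.finrank E E') <;> norm_num

end FinClosure

/-! ## The converse of `localRestrictionKer_le_of_tower`, up to the index -/

section Tower

variable {K : Type u} [Field K] (W : WeierstrassCurve K)
variable {E : Type u} [Field E] [Algebra K E]
variable {E' : Type u} [Field E'] [Algebra K E'] [Algebra E E'] [IsScalarTower K E E']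

/-- For `E'/E` algebraic, the map on points `E(Ē) → E(Ē')` along an `E`-embedding `Ē → Ē'` is
bijective (the embedding is then an isomorphism). [folklore] -/
theorem pointsMapTower_bijective [Algebra.IsAlgebraic E E']
    (ι₂ : AlgebraicClosure E →ₐ[E] AlgebraicClosure E') :
    Function.Bijective (pointsMapTower (K := K) W ι₂) := by
  let e := algEquivOfEmb E' ι₂
  refine ⟨WeierstrassCurve.Affine.Point.map_injective (W' := W) (ι₂.restrictScalars K),
    fun P ↦ ?_⟩
  refine ⟨WeierstrassCurve.Affine.Point.map
    ((e.symm : AlgebraicClosure E' →ₐ[E] AlgebraicClosure E).restrictScalars K)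
    (show (W.baseChange (AlgebraicClosure E')).toAffine.Point from P), ?_⟩
  rw [pointsMapTower_apply]
  change WeierstrassCurve.Affine.Point.map _ (WeierstrassCurve.Affine.Point.map _ _) = _
  rw [WeierstrassCurve.Affine.Point.map_map]
  have hc : (ι₂.restrictScalars K).comp
      ((e.symm : AlgebraicClosure E' →ₐ[E] AlgebraicClosure E).restrictScalars K) =
        AlgHom.id K (AlgebraicClosure E') := by
    ext z
    exact e.apply_symm_apply z
  rw [hc]
  rcases P with _ | _ <;> rfl

variable [FiniteDimensional E E'] [CharZero E]

/-- **Up to `[Γ_E : Γ_{Ẽ'}]`, a class dying over `E'` dies over `E`.** If `c ∈ H¹(K, E)` dies in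
`H¹(E', E)` then `[Γ_E : Γ_{Ẽ'}] • c` dies in `H¹(E, E)`: the restriction to `E'` factors as
`H¹(K, E) → H¹(E, E) → H¹(E', E)` (`resGalOfEmb_comp_tower`, independence of the embedding
`localRestrictionKerOfEmb_eq_holds`), the kernel of the second map is inflated from `Γ_{Ẽ'}`
(`resKer_le_range_inflClass`, the coefficient map `E(Ē) → E(Ē')` being bijective) and inflated
classes are killed by the index (`index_nsmul_inflClass`).
Serre, *Galois Cohomology*, I.§2.4 (Cor. to Prop. 9), I.§5.8.
[cite: SerreGaloisCohomology1997, I.§2.4 Cor. to Prop. 9] -/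
theorem index_nsmul_mem_localRestrictionKer_of_tower {c : W.galH1}
    (hc : c ∈ W.localRestrictionKer E') :
    (finGalSubgroup (E := E) E').index • c ∈ W.localRestrictionKer E := by
  let ι₁ : AlgebraicClosure K →ₐ[K] AlgebraicClosure E := closureEmb (K := K) E
  let ι₂ : AlgebraicClosure E →ₐ[E] AlgebraicClosure E' := closureEmb (K := E) E'
  rw [← WeierstrassCurve.localRestrictionKerOfEmb_eq_holds W E' ((ι₂.restrictScalars K).comp ι₁)]
    at hc
  change c ∈ resKer (resGalOfEmb ((ι₂.restrictScalars K).comp ι₁))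
    (pointsMapOfEmb W ((ι₂.restrictScalars K).comp ι₁)) (pointsMapOfEmb_smul W _) at hc
  rw [resKer_eq_ker, AddMonoidHom.mem_ker,
    resH1Hom_congr (resGalOfEmb_comp_tower ι₁ ι₂) (pointsMapOfEmb_comp_tower W ι₁ ι₂) _
      (fun x m ↦ by
        simp only [ContinuousMonoidHom.comp_toFun, AddMonoidHom.coe_comp, Function.comp_apply,
          pointsMapOfEmb_smul, pointsMapTower_smul]),
    ← resH1Hom_comp (resGalOfEmb ι₁) (pointsMapOfEmb W ι₁) (pointsMapOfEmb_smul W ι₁)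
      (resGalOfEmb (K := E) ι₂) _ (pointsMapTower_smul W ι₂), AddMonoidHom.comp_apply,
    ← AddMonoidHom.mem_ker, ← resKer_eq_ker] at hc
  -- the middle restriction: its kernel is inflated from `Γ_{Ẽ'}`, killed by the index
  obtain ⟨f, hf⟩ := resKer_le_range_inflClass (resGalOfEmb (K := E) ι₂) (pointsMapTower W ι₂)
    (pointsMapTower_smul W ι₂) (pointsMapTower_bijective W ι₂) (finGalSubgroup (E := E) E')
    (isOpen_finGalSubgroup E') (finGalSubgroup_le_range_resGal E') hc
  have hkill := index_nsmul_inflClass (finGalSubgroup (E := E) E') (isOpen_finGalSubgroup E') f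
  rw [hf, ← map_nsmul] at hkill
  exact hkill

/-- **For `[E' : E] ≤ 2`, a class dying over `E'` dies over `E` after multiplication by `2`.**
[cite: SerreGaloisCohomology1997, I.§2.4 Cor. to Prop. 9] -/
theorem two_nsmul_mem_localRestrictionKer_of_tower (h : Module.finrank E E' ≤ 2) {c : W.galH1}
    (hc : c ∈ W.localRestrictionKer E') : 2 • c ∈ W.localRestrictionKer E := by
  obtain ⟨k, hk⟩ := index_finGalSubgroup_dvd_two (E := E) E' h
  rw [hk, mul_nsmul]
  exact AddSubgroup.nsmul_mem _ (index_nsmul_mem_localRestrictionKer_of_tower (E := E) W hc) k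

end Tower

/-! ## Quadratic extensions of number fields: `res x ∈ Ш(E_L/L) ⇒ 2x ∈ Ш(E/K)` -/

section NumberField

open NumberField IsDedekindDomain

variable {K : Type u} [Field K] [NumberField K] (W : WeierstrassCurve K)
variable (L : Type u) [Field L] [NumberField L] [Algebra K L]

omit [NumberField L] in
/-- Every finite place of `K` lies below a finite place of `L`. [folklore] -/
theorem exists_liesOver (v : HeightOneSpectrum (𝓞 K)) :
    ∃ w : HeightOneSpectrum (𝓞 L), w.asIdeal.LiesOver v.asIdeal := by
  haveI := v.isMaximal
  obtain ⟨Q, hQmax, hQ⟩ := Ideal.exists_maximal_ideal_liesOver_of_isIntegral (S := 𝓞 L) v.asIdeal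
  have hQ0 : Q ≠ ⊥ := by
    intro h
    apply v.ne_bot
    rw [hQ.over, h, Ideal.under_bot]
  exact ⟨⟨Q, hQmax.isPrime, hQ0⟩, hQ⟩

/-- **Finite places: `[L_w : K_v] ≤ [L : K]`** for the continuous extension `K_v → L_w` of
`K → L` (the tree's `adicCompletionMap`), with `L_w` finite over `K_v` (Mathlib's instance from
the density of `K_v ⊗ L → L_w`; the tree's `finrank_adicCompletion_le`). [folklore] -/
theorem finrank_adicCompletion_le_of_liesOver (v : HeightOneSpectrum (𝓞 K))
    (w : HeightOneSpectrum (𝓞 L)) [w.asIdeal.LiesOver v.asIdeal] :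
    letI : Algebra (v.adicCompletion K) (w.adicCompletion L) :=
      (adicCompletionMap (K := K) L v w).toAlgebra
    FiniteDimensional (v.adicCompletion K) (w.adicCompletion L) ∧
      Module.finrank (v.adicCompletion K) (w.adicCompletion L) ≤ Module.finrank K L := by
  have hcont : Continuous (adicCompletionMap (K := K) L v w) := by
    unfold adicCompletionMap
    exact (HeightOneSpectrum.adicCompletion.continuous_ofCompletion L w).comp
      ((UniformSpace.Completion.continuous_map).comp
        (HeightOneSpectrum.adicCompletion.continuous_toCompletion K v))
  have hcoe : ∀ x : K, adicCompletionMap (K := K) L v w (algebraMap K (v.adicCompletion K) x) =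
      algebraMap L (w.adicCompletion L) (algebraMap K L x) := fun x ↦
    adicCompletionMap_coe (K := K) L v w x
  letI : Algebra (v.adicCompletion K) (w.adicCompletion L) :=
    (adicCompletionMap (K := K) L v w).toAlgebra
  haveI : IsScalarTower K (v.adicCompletion K) (w.adicCompletion L) :=
    IsScalarTower.of_algebraMap_eq fun x ↦ by
      rw [RingHom.algebraMap_toAlgebra, hcoe, ← IsScalarTower.algebraMap_apply]
  haveI : ContinuousSMul (v.adicCompletion K) (w.adicCompletion L) :=
    ⟨(hcont.comp continuous_fst).mul continuous_snd⟩
  exact ⟨inferInstance, QuadraticForms.finrank_adicCompletion_le K L v w hcont hcoe⟩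

omit [NumberField K] [NumberField L] in
/-- **Infinite places: `[L_w : K_v] ≤ 2`** (Mathlib: the completion at an infinite place `w`
over `v` has degree `1` if `w` is unramified over `K` and `2` otherwise), and `L_w` is finite
over `K_v`. [folklore] -/
theorem finrank_completion_le_two (v : InfinitePlace K) (w : InfinitePlace L) [w.1.LiesOver v.1] :
    letI : Algebra v.Completion w.Completion := NumberField.LiesOver.instAlgebraCompletion
    FiniteDimensional v.Completion w.Completion ∧
      Module.finrank v.Completion w.Completion ≤ 2 := by
  letI : Algebra v.Completion w.Completion := NumberField.LiesOver.instAlgebraCompletion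
  have hrank : Module.finrank v.Completion w.Completion = 1 ∨
      Module.finrank v.Completion w.Completion = 2 := by
    by_cases h : w.IsUnramified K
    · exact Or.inl (InfinitePlace.Completion.finrank_eq_one_of_isUnramified v h)
    · exact Or.inr (InfinitePlace.Completion.finrank_eq_two_of_isRamified v h)
  have hpos : 0 < Module.finrank v.Completion w.Completion := by
    rcases hrank with h | h <;> omega
  have hle : Module.finrank v.Completion w.Completion ≤ 2 := by
    rcases hrank with h | h <;> omega
  exact ⟨Module.finite_of_finrank_pos hpos, hle⟩

/-- **If `res x ∈ Ш(E_L/L)` for a quadratic extension `L/K` then `2x ∈ Ш(E/K)`.** At a place `v`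
of `K` pick a place `w` of `L` above it; `res x` dies in `H¹(L_w, E_L)`, i.e. `x` dies in
`H¹(L_w, E)` (`mem_localRestrictionKer_iff_resBaseChange_mem`), hence `2x` dies in `H¹(K_v, E)`
(`two_nsmul_mem_localRestrictionKer_of_tower`, `[L_w : K_v] ≤ [L : K] = 2`). This is the local
half of "the cokernel of `Sel(E/K) → Sel(E/F)^G` is killed by `|G|²`" (Dokchitser–Dokchitser
2010, proof of Lemma 4.14). [cite: DokchitserDokchitserAnnals2010, Lemma 4.14 (proof)] -/
theorem two_nsmul_mem_sha_of_resBaseChange_mem_sha (h2 : Module.finrank K L ≤ 2) {x : W.galH1}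
    (hx : resBaseChange W L x ∈ (W.baseChange L).sha) : 2 • x ∈ W.sha := by
  rw [WeierstrassCurve.mem_sha_iff] at hx ⊢
  refine ⟨fun v ↦ ?_, fun v ↦ ?_⟩
  · -- finite places
    obtain ⟨w, hw⟩ := exists_liesOver L v
    haveI := hw
    obtain ⟨hfin, hle⟩ := finrank_adicCompletion_le_of_liesOver L v w
    letI : Algebra (v.adicCompletion K) (w.adicCompletion L) :=
      (adicCompletionMap (K := K) L v w).toAlgebra
    haveI : IsScalarTower K (v.adicCompletion K) (w.adicCompletion L) :=
      IsScalarTower.of_algebraMap_eq fun x ↦ (adicCompletionMap_coe (K := K) L v w x).symm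
    haveI : FiniteDimensional (v.adicCompletion K) (w.adicCompletion L) := hfin
    haveI : CharZero (v.adicCompletion K) :=
      charZero_of_injective_algebraMap (algebraMap K (v.adicCompletion K)).injective
    have hx' : x ∈ W.localRestrictionKer (w.adicCompletion L) :=
      (mem_localRestrictionKer_iff_resBaseChange_mem W x).mpr (hx.1 w)
    exact two_nsmul_mem_localRestrictionKer_of_tower W (E := v.adicCompletion K)
      (hle.trans h2) hx'
  · -- infinite places
    obtain ⟨w, hw⟩ := InfinitePlace.comap_surjective (k := K) (K := L) v
    subst hw
    set v : InfinitePlace K := w.comap (algebraMap K L)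
    haveI : w.1.LiesOver v.1 := ⟨rfl⟩
    obtain ⟨hfin, hle⟩ := finrank_completion_le_two (K := K) L v w
    haveI : IsScalarTower K L w.Completion := IsScalarTower.of_algebraMap_eq fun x ↦ by
      apply NumberField.InfinitePlace.Completion.ext
      rw [NumberField.InfinitePlace.Completion.algebraMap_toCompletion,
        NumberField.InfinitePlace.Completion.algebraMap_toCompletion,
        UniformSpace.Completion.algebraMap_def, UniformSpace.Completion.algebraMap_def,
        IsScalarTower.algebraMap_apply K L (WithAbs w.1)]
    letI : Algebra v.Completion w.Completion := NumberField.LiesOver.instAlgebraCompletion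
    haveI : IsScalarTower K v.Completion w.Completion :=
      NumberField.LiesOver.instIsScalarTowerCompletion
    haveI : FiniteDimensional v.Completion w.Completion := hfin
    haveI : CharZero v.Completion :=
      charZero_of_injective_algebraMap (algebraMap K v.Completion).injective
    have hx' : x ∈ W.localRestrictionKer w.Completion :=
      (mem_localRestrictionKer_iff_resBaseChange_mem W x).mpr (hx.2 w)
    exact two_nsmul_mem_localRestrictionKer_of_tower W (E := v.Completion) hle hx'

/-- **If `res η ∈ Sel_{p^∞}(E_L/L)` for a quadratic extension `L/K` then `2η ∈ Sel_{p^∞}(E/K)`**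
(for any map `r : H¹(K, E[p^∞]) → H¹(L, E_L[p^∞])` covering the restriction `H¹(K, E) → H¹(L, E_L)`,
e.g. the tree's restriction of `SelmerPInftyRestriction`): the Selmer groups are the preimages
of `Ш` (`selmerGroupPInfty_eq_comap_sha`). Dokchitser–Dokchitser 2010, proof of Lemma 4.14.
[cite: DokchitserDokchitserAnnals2010, Lemma 4.14 (proof)] -/
theorem two_nsmul_mem_selmerGroupPInfty_of_res_mem (h2 : Module.finrank K L ≤ 2) (p : ℕ)
    (r : galH1Primary W p →+ galH1Primary (W.baseChange L) p)
    (hr : ∀ η, primaryH1ToH1 (W.baseChange L) p (r η) = resBaseChange W L (primaryH1ToH1 W p η))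
    {η : galH1Primary W p} (hη : r η ∈ selmerGroupPInfty (W.baseChange L) p) :
    2 • η ∈ selmerGroupPInfty W p := by
  rw [selmerGroupPInfty_eq_comap_sha, AddSubgroup.mem_comap] at hη ⊢
  rw [hr] at hη
  rw [map_nsmul]
  exact two_nsmul_mem_sha_of_resBaseChange_mem_sha W L h2 hη

end NumberField

end Literature.NumberTheory.EllipticCurves
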